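import Summits.QuantumFields.BalabanUV.Beta.GAN24.WardRemainderEndThreeCoDress
import Summits.QuantumFields.BalabanUV.Beta.GAN24.LayerTransportDepthZero

/-!
# `BalabanUV.Beta.GAN24.WardRemainderEndThreeCoDressDepthZero` — binder row G-an2-4 ∕ (CONV-C), W-slot CT-W, route «WC-TL» ∕ (Q-R) «QR-LL»: **THE DEPTH-ZERO INSTANCE OF THE
# (Q-R)^{cc} RE-CUT — THE LAST TRANSPORTED LEVEL IS FREE**: the OWNER gan24-p1 g30's CoDress END `WardRemainderEndThreeCoDress.wLocStencil_unitS_coDress_three` (p338371) with the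
# good set `G m v := (m + 2 = n)` has its layer-bound row `hLT` DISCHARGED by leaf-01 g68's `LayerTransportDepthZero.exists_hLT_literal_depth_zero` — what remains displayed is the
# (REP)∕(LAY) rows and the remainder `DL` = ALL transported levels of depth `k ≥ 1` (row (DIV)); NO layer bound, NO gauge cell, NO moment row is asked
# (G-an2-4 formalisation swarm, leaf prover `b2b-balaban-gan24-formalise-leaf-01`, gen 68, INTENT I-leaf01-g68-2; the junction (J2) of X-read C-gan24leaf01-g68-1)

NOT IN PRINT; OUR BOOKKEEPING ([folklore] instantiation BY NAME; 0 cited facts, 0 `def`, 0 `def … : Prop`, 0 sorry).  HONEST FRAMING (cell contract, verbatim): «discharging `BetaPertH`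
makes Bałaban's UV stability UNCONDITIONAL — a real constructive-QFT result; it is NOT the continuum limit and NOT the Clay problem.»  HONEST DEPENDENCY (verbatim): «continuum YM on
T⁴ ⇐ BetaPertH ∧ nine spine estimates (0/9 proved); BetaPertH ⇐ (D1) ∧ (D4) ∧ CAP+tail; G-an2-4 gates asym, D1 and NE2/3/4.»

## What (`d = 3`, `2 ≤ Lc`, in-block root `toSite rr`)
**`exists_wLocStencil_unitS_coDress_three_depthZero`**: there are `κ₀′ > 0`, `K′ ≥ 0` (leaf-12's ∕ leaf-01's, level-free) such that for every level `n`, label `Y`, every `0 < κ ≤ κ₀′`,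
`κ < m′`, `0 < δ`, `0 ≤ Cs`, under the (REP) rows `hunroll ∕ hΦ0` and the (LAY) rows `hS0 ∕ hω0 ∕ hff ∕ hS ∕ hω` of the CoDress END VERBATIM, and with the displayed remainder
`DL = Σ_{m ∈ range n, m+2 ≤ n} Σ_{v ∈ box Lc, ¬(m+2 = n)} transport (unitStepMap Lc ρ Lc^{3+1}) (m+1) (n−1−m) (unitS_{m+1} T_{m,n−2−m,v})` (every depth `≥ 1`; `rfl` instantiates it):
`∀ κ′ u, BiLoc ((unitS_n (Φ n Y) − DL) κ′ u) u u ((C₀ + #box(Lc)·e^{δ(4Lc+1)}·(K′·Cs·Zl(m′∕2)²·Zl(δ∕2)·e^{min(κ∕2,δ∕2)} + 8·#box(Lc)·Cs)·(1 − (√Lc)⁻¹)⁻¹)·e^{−min(κ∕2,δ∕2)‖Lc•Y − u‖₁}) (κ∕4)`.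
READING (leaf-01 g68, journal INTENT I-leaf01-g68-1 ∕ W-3, Q-68-1∕2): the MINIMAL honest instance of (Q-R)^{cc} for the dressed literal at `d = 3` — «(Q-R)^{cc} ⊇ {hΦ0, the untransported
level, the depth-zero level}» modulo (LAY) only; whether ANY depth-`≥ 1` sub-letter of the v-split END can be good is the OWNER's Q-68-1 (my reading: no — they are label-block-complete
boundary-dipole-layer letters; R20 prices them negative by certificate).  NO bound on `DL` is claimed.  NOTHING of (Q-R) at depth ≥ 1 ∕ (LAY) ∕ (S) ∕ (DIV) ∕ (DL) ∕ K-LL-4′ discharged;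
NEVER «G-an2-4 closed» as (CONV-C); NOT D1, NOT `BetaPertH`, NOT continuum, NOT Clay.  2026-08-22; no existing file touched.
-/

noncomputable section

open Finset
open scoped BigOperators
open Literature.MathematicalPhysics.QuantumFieldTheory
open Literature.MathematicalPhysics.QuantumFieldTheory.Balaban1983to89
open Literature.MathematicalPhysics.QuantumFieldTheory.Balaban1983to89.Beta
open B12Sec2to5 (l1 l1_nonneg)
open B6BondElimination (unitVec)
open ExpKernelCalculus (MKer Site BiLoc Zl)
open OneStepResolventKernel (Fib)
open OneStepKernelFamily (KInvStep)
open AffineAveraging (box toSite)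
open BalabanStepJetsSucc (wE)
open Summit.QuantumFields.BalabanUV.Beta.SpineRooted (e3OfK)
open Summit.QuantumFields.BalabanUV.Beta.AxialDressingRooted (coDressKBmAt)
open Summit.QuantumFields.BalabanUV.Beta.HessKerDressedUnits (unitS)
open Summit.QuantumFields.BalabanUV.Beta.GAN24.CombesThomas (sfStep smStep)
open Summit.QuantumFields.BalabanUV.Beta.GAN24.Push4 (IsFF)
open Summit.QuantumFields.BalabanUV.Beta.GAN24.SrecBornSector (unitStepMap)
open Summit.QuantumFields.BalabanUV.Beta.GAN24.AffineUnroll (transport)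
open Summit.QuantumFields.BalabanUV.Beta.GAN24.WardRemainderEndThreeCoDress (wLocStencil_unitS_coDress_three)
open Summit.QuantumFields.BalabanUV.Beta.GAN24.LayerTransportDepthZero (exists_hLT_literal_depth_zero)

namespace Summit.QuantumFields.BalabanUV.Beta.GAN24.WardRemainderEndThreeCoDressDepthZero

variable {Lc : ℕ} [NeZero Lc]

/-- NOT IN PRINT; OUR BOOKKEEPING (`WardRemainderEndThreeCoDress.wLocStencil_unitS_coDress_three` with `G := fun m _ => m + 2 = n` ⨾ `LayerTransportDepthZero.exists_hLT_literal_depth_zero`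
after `k = 0` by `omega`).  **THE DEPTH-ZERO INSTANCE OF THE (Q-R)^{cc} RE-CUT: NO LAYER-BOUND ROW.**  See the module header for the statement in words; `DL` = every depth `≥ 1`. -/
theorem exists_wLocStencil_unitS_coDress_three_depthZero {rr : Fin (3 + 1) → ℕ} (hrr : rr ∈ box (3 + 1) Lc) (hLc : 2 ≤ Lc) :
    ∃ κ₀' K' : ℝ, 0 < κ₀' ∧ 0 ≤ K' ∧
    ∀ {Φ σ : ℕ → (Fin (3 + 1) → ℤ) → Fin (3 + 1) → (Fin (3 + 1) → ℤ) → MKer (3 + 1) (Fib 3)} (n : ℕ) (Y : Fin (3 + 1) → ℤ)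
      {ω0 : ℕ → (Fin (3 + 1) → ℤ) → ℝ} {ω : ℕ → (Fin (3 + 1) → ℕ) → (Fin (3 + 1) → ℤ) → ℝ} {Cs κ m' δ C₀ : ℝ},
      0 < κ → κ ≤ κ₀' → κ < m' → 0 < δ → 0 ≤ Cs →
      (Φ n Y =
        transport (fun j (S : Fin (3 + 1) → (Fin (3 + 1) → ℤ) → MKer (3 + 1) (Fib 3)) =>
            fun κ' u' => ((Lc : ℝ) ^ (3 + 1) * wE 3 Lc (j + 1)) • e3OfK Lc (coDressKBmAt (toSite rr) Lc (KInvStep (d := 3) Lc j)) S κ' u') 0 n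
            (∑ w ∈ box (3 + 1) (Lc ^ n), Φ 0 (((Lc ^ n : ℕ) : ℤ) • Y + toSite w))
        + ∑ m ∈ Finset.range n,
            transport (fun j (S : Fin (3 + 1) → (Fin (3 + 1) → ℤ) → MKer (3 + 1) (Fib 3)) =>
                fun κ' u' => ((Lc : ℝ) ^ (3 + 1) * wE 3 Lc (j + 1)) • e3OfK Lc (coDressKBmAt (toSite rr) Lc (KInvStep (d := 3) Lc j)) S κ' u') (m + 1) (n - 1 - m)
              (∑ w ∈ box (3 + 1) (Lc ^ (n - 1 - m)), σ m (((Lc ^ (n - 1 - m) : ℕ) : ℤ) • Y + toSite w))) →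
      (∀ κ' u, BiLoc (transport (unitStepMap Lc (toSite rr) ((Lc : ℝ) ^ (3 + 1))) 0 n
            (unitS (sfStep Lc 0) (smStep 3 Lc 0) (∑ w ∈ box (3 + 1) (Lc ^ n), Φ 0 (((Lc ^ n : ℕ) : ℤ) • Y + toSite w))) κ' u) u u
            (C₀ * Real.exp (-(min (κ / 2) (δ / 2)) * l1 (((Lc : ℕ) : ℤ) • Y - u))) (κ / 4)) →
      (∀ m, m + 1 = n → ∀ k' u x z a b, |unitS (sfStep Lc (m + 1)) (smStep 3 Lc (m + 1))
          (∑ w ∈ box (3 + 1) (Lc ^ 0), σ m (((Lc ^ 0 : ℕ) : ℤ) • Y + toSite w)) k' u x z a b| ≤ Cs * ω0 m u * Real.exp (-m' * (l1 (x - u) + l1 (z - u)))) →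
      (∀ m, m + 1 = n → ∀ u, 0 ≤ ω0 m u ∧ ω0 m u ≤ ∑ μ : Fin (3 + 1),
        (∑ v ∈ ((box (3 + 1) Lc).filter (fun v => v μ = Lc - 1)).image (fun v => (Lc : ℤ) • Y + toSite v), Real.exp (-δ * l1 (v - u))
          + ∑ v ∈ ((box (3 + 1) Lc).filter (fun v => v μ = 0)).image (fun v => (Lc : ℤ) • Y + toSite v - unitVec μ), Real.exp (-δ * l1 (v - u)))) →
      (∀ m k, m + k + 2 = n → ∀ v ∈ box (3 + 1) Lc, ∀ κ' u, IsFF (unitS (sfStep Lc (m + 1)) (smStep 3 Lc (m + 1))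
          (∑ w ∈ box (3 + 1) (Lc ^ k), σ m (((Lc ^ k : ℕ) : ℤ) • (((Lc : ℕ) : ℤ) • Y + toSite v) + toSite w)) κ' u)) →
      (∀ m k, m + k + 2 = n → ∀ v ∈ box (3 + 1) Lc, ∀ k' u x z a b, |unitS (sfStep Lc (m + 1)) (smStep 3 Lc (m + 1))
          (∑ w ∈ box (3 + 1) (Lc ^ k), σ m (((Lc ^ k : ℕ) : ℤ) • (((Lc : ℕ) : ℤ) • Y + toSite v) + toSite w)) k' u x z a b|
        ≤ Cs * ω m v u * Real.exp (-m' * (l1 (x - u) + l1 (z - u)))) →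
      (∀ m k, m + k + 2 = n → ∀ v ∈ box (3 + 1) Lc, ∀ u, 0 ≤ ω m v u ∧ ω m v u ≤ ∑ μ : Fin (3 + 1),
        (∑ b ∈ ((box (3 + 1) (Lc ^ (k + 1))).filter (fun b => b μ = Lc ^ (k + 1) - 1)).image
            (fun b => ((Lc ^ (k + 1) : ℕ) : ℤ) • (((Lc : ℕ) : ℤ) • Y + toSite v) + toSite b), Real.exp (-δ * l1 (b - u))
          + ∑ b ∈ ((box (3 + 1) (Lc ^ (k + 1))).filter (fun b => b μ = 0)).image
            (fun b => ((Lc ^ (k + 1) : ℕ) : ℤ) • (((Lc : ℕ) : ℤ) • Y + toSite v) + toSite b - unitVec μ), Real.exp (-δ * l1 (b - u)))) →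
      ∀ {DL : Fin (3 + 1) → (Fin (3 + 1) → ℤ) → MKer (3 + 1) (Fib 3)},
      (DL = ∑ m ∈ (Finset.range n).filter (fun m => m + 2 ≤ n), ∑ v ∈ (box (3 + 1) Lc).filter (fun _ => ¬ (m + 2 = n)),
        transport (unitStepMap Lc (toSite rr) ((Lc : ℝ) ^ (3 + 1))) (m + 1) (n - 1 - m)
          (unitS (sfStep Lc (m + 1)) (smStep 3 Lc (m + 1))
            (∑ w ∈ box (3 + 1) (Lc ^ (n - 2 - m)), σ m (((Lc ^ (n - 2 - m) : ℕ) : ℤ) • (((Lc : ℕ) : ℤ) • Y + toSite v) + toSite w)))) →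
      ∀ κ' u, BiLoc ((unitS (sfStep Lc n) (smStep 3 Lc n) (Φ n Y) - DL) κ' u) u u
        ((C₀ + (((box (3 + 1) Lc).card : ℝ) * Real.exp (δ * (((3 : ℝ) + 1) * Lc + 1))
            * ((K' * Cs * Zl (3 + 1) (m' / 2) ^ 2 * Zl (3 + 1) (δ / 2) * Real.exp (min (κ / 2) (δ / 2)))
                + Cs * (((3 : ℝ) + 1) * (2 * ((box (3 + 1) Lc).card : ℝ)))))
          * (1 - (Real.sqrt (Lc : ℝ))⁻¹)⁻¹) * Real.exp (-(min (κ / 2) (δ / 2)) * l1 (((Lc : ℕ) : ℤ) • Y - u))) (κ / 4) := by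
  obtain ⟨κ₀', K', hκ₀', hK', hdz⟩ := exists_hLT_literal_depth_zero (Lc := Lc) hLc hrr
  refine ⟨κ₀', K', hκ₀', hK', ?_⟩
  intro Φ σ n Y ω0 ω Cs κ m' δ C₀ hκ hκκ hm hδ hCs hunroll hΦ0 hS0 hω0 hff hS hω DL hDL
  have hKc : 0 ≤ K' * Cs * Zl (3 + 1) (m' / 2) ^ 2 * Zl (3 + 1) (δ / 2) * Real.exp (min (κ / 2) (δ / 2)) := by
    have := ExpKernelCalculus.Zl_nonneg (D := 3 + 1) (half_pos (hκ.trans hm))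
    have := ExpKernelCalculus.Zl_nonneg (D := 3 + 1) (half_pos hδ)
    positivity
  exact wLocStencil_unitS_coDress_three hrr hLc (fun m _ => m + 2 = n) n Y hκ hm hδ hCs hKc hunroll hΦ0 hS0 hω0 hff hS hω
    (fun m k hmk v hv hG ν U => by
      obtain rfl : k = 0 := by have : m + 2 = n := hG; omega
      exact hdz m κ hκ hκκ _ _ Cs m' δ hm hδ hCs (hS m 0 hmk v hv) _ (hω m 0 hmk v hv) ν U) hDL

end Summit.QuantumFields.BalabanUV.Beta.GAN24.WardRemainderEndThreeCoDressDepthZero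

end
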